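import Literature.MathematicalPhysics.QuantumFieldTheory.Balaban1983to89.B3Op116MixedSeed
import Literature.MathematicalPhysics.QuantumFieldTheory.Balaban1983to89.B3Op116DKernelRegularTorus

/-!
# Bałaban, *(Higgs)₂,₃ quantum fields in a finite volume III. Renormalization* [B3] — the kernel of the operator (1.16) p. 414: THE
MIXED (dipole-source) ENTRY `D_x(1.16)_{n,n′}D^*_{x′}` IS UNIFORMLY BOUNDED AND EXPONENTIALLY DECAYING ON THE TORUS FOR ALL `n + n′ > d`,
`n′ ≥ 1` — the `hM` binder of the (2.5) assembly `B3Ineq25Op116Smooth.ineq25At_op116_smooth_torus_of_bounds` (FILE 5(b), part A)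

statement-level skeleton of published theorems with citation tags; proofs where landed; nothing here is a claim about the Yang–Mills mass gap

T. Bałaban, Commun. Math. Phys. **88** (1983) 411–445 [cite: Balaban1983Higgs3]; part I, Commun. Math. Phys. **85** (1982) 603–636
[cite: Balaban1982Higgs1].  PDFs held: `paper:balaban1983-higgs-2-3-quantum-fields-finite-volume` (journal page = PDF page + 410;
p. 414 = `p0004.txt`, p. 424 = `p0014.txt`, p. 426 = `p0016.txt`), `paper:balaban1982-cmp85-higgs23-i` (p. 619 = `p0017.txt`).

CITATION HEADER (lean-in-tree rule).  Cell `lit-balaban` (HOME `run/shared/lean/pub/lit-balaban/`), Phase-2 proof seat **p40** gen 74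
(unit `lit-balaban-p40`); TAKING line HOME/STATUS 2026-08-23T07:40Z («FILE 5(b)» of r14's (1.16) programme `DESIGN-B3-116-analytic.md`,
p35's `DESIGN-FILE4.md` §9).  SKELETON rows **B3.Eq1.16** / **B3.Eq2.5** (fold owner r15; decl of record
`B3Sect2StatementsPart2.ScaledKernels.Ineq25At`, the `hM`/`hM′` slots of p40's `B3Ineq25Op116Smooth.ineq25At_op116_smooth_torus_of_bounds`) —
a located member (no head claim).  USED BY NAME, never restated: p40 gen 73's `B3Op116MixedSeed.mixed_seed_state` (the Calderón–Zygmund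
seed: `Wdip^B_{b′}Y` in the state `0`, `W = G_k(T,A+B) − G_k(T,B)`; constants `seedK1`, `seedK2`, `kC`, `gE`), p35 gen 22's
`B3Op116DKernelRegularTorus.{seqC, rateAt, cvAt, cdAt, seqC_zero, seqC_succ, seqC_pos, step_state, state_op116_one_right,
state_op116_succ_right, rateAt_closed, mesh_rpow_split, rate_div_eq, cK1, kap4}` (the induction over the factors of (1.16) from an
ARBITRARY seed triple, with its v1.2 dipole entry points) and `B3Op116MajorantStep.{maj, maj_rate_mono, maj_const_mono, maj_add,
maj_exponent_reduce, maj_nonneg}`, p33's `B3Op116MajorantConvolution.majorant_le_top`, p40 g70's `B3Eq116TwoSidedExpansion.{op116,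
eq344_model, eq344_model_right}` ((I.3.44) both ways; p35's v1.4 seed glue `W_apply_eq_op116_zero_one/_one_zero`, in review at filing
time, states the same two readings — used here as local rewrites only), r14's `B3Op116SourceForm.{srcV, opV_apply_eq_srcV, covDerivAt,
op116_succ_left_apply, op116_zero_zero_apply}` and `B3Op116DKernelRegularTorus.state_op116_add_left` (v1.3), p40's
`B3Ineq210MixedRegularTorus.{dip, onb, norm_onb}`, r15's carrier predicate `ScaledKernels.Ineq210` on r14's `regRegionKernels`, p33's
`B3Ineq210MixedRegularRegion.mixedTermR` shape.

## What is printed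

[B3] p. 414 [PDF 4] (verbatim): *"in the last term of this expansion, equal to [G_k(Ω,B̃)V_k(Ã,B̃)]^n G_k(Ω,Ã+B̃)[V_k(Ã,B̃)G_k(Ω,B̃)]^{n′},
(1.16) we have the propagator G_k(Ω,Ã+B̃). … for n, n′ sufficiently large, a kernel of the operator (1.16) is a sufficiently regular
function of both variables. More exactly the Hölder norms of the covariant derivatives of this kernel, the norms defined for example in
the inequalities (I.2.24) and (I.2.25) of Proposition I.2.1, are exponentially decaying with the distance of the arguments and are
uniformly bounded by O(1)(e(L^kε)^{1−α})^{n+n′}, where α > 0 but can be arbitrarily small. This estimate follows easily from the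
properties of the propagators G_k(Ω, A) proved in the next paper."*  [B1] p. 619 [PDF 17], (3.44): `G_k(Ω,A+B) = G_k(Ω,B) +
G_k(Ω,B)V_kG_k(Ω,A+B)`.  [B3] p. 426 [PDF 16], (2.10): *"|G^η_{(j)}(Ω, B̃; x, x′)| ≤ O(1)(L^jη)^{−d+2}e^{−δ₁(L^jη)^{−1}|x−x′|}, (2.10) and if
the propagator is differentiated, then for each differentiation, there is an additional factor (L^jη)^{−1} on the right side."*  The entry
`D_x(kernel)D^*_{x′}` of (1.16) is the member of the (I.2.25)/(1.32) norm with one covariant derivative in EACH variable (a dipole source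
read through a row derivative); its bound is part of what the print calls "follows easily".

## What this file proves, and how

§1 constants: the seed triple of p40 g73's `mixed_seed_state` for a unit charge (`cvW`, `cdW`, rate `δ₀ = δ₁/(4L)`), and the WEAKENED
triple `(dipRate, cvDip, cdDip) = (δ₀/(4L), cvW + L^kε·cvAt(1), cdW + L^kε·cdAt(1))`; signs (`seedK1_nonneg`, `seedK2_nonneg`, …).
§2 **THE TWO INNER SEEDS WITHOUT A SECOND CALDERÓN–ZYGMUND STEP.**  By (I.3.44) read both ways (p40 g70's `eq344_model`,
`eq344_model_right`; p35's v1.4 `W_apply_eq_op116_zero_one`/`_one_zero` state the same readings): `G_k(T,A+B)V_kG_k(T,B) = W` and THE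
SECOND SEED IDENTITY `G_k(T,B)V_kG_k(T,B) = W − G_k(T,B)V_kW` (`GB_srcV_GB_eq`) as operators.  `Wdip^B_{b′}Y` is in the state `0` of `(δ₀, cvW, cdW)` (the mixed seed); `G_k(T,B)V_k(Wdip Y)` is then in the state `1`
(p35's `step_state`), brought back to the state `0` at the cost `L^kε` per unit of exponent (`maj_exponent_reduce`) and the rate `δ₀/(4L)`:
hence BOTH `G_k(T,X)V_kG_k(T,B)dip^B_{b′}Y`, `X ∈ {B, A+B}`, are in the state `0` of the weakened triple (`seed_state`).
§3 **THE STATE OF `(1.16)_{n,n′}dip^B_{b′}Y`** (`dip_state`): for `n′ = n″ + 1 ≥ 1` it is in the state `n + n″` of the weakened triple —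
p35's v1.2 entry points `state_op116_succ_right` (`n′ ≥ 2`, both inner seeds) and `state_op116_one_right` (`n′ = 1`, the seed `W`); for
`n′ = 0` (`dip_state_zero_right`) `(1.16)_{m+1,0}dip` is in the state `m` by p35's v1.3 `state_op116_add_left` from `(1.16)_{1,0} = W`.
§4 **THE THEOREM `kernel116_mixed_le`**: on `Ω = T_ε`, for `n′ ≥ 1` and `d < n + n′`,
`ε^{−d}·ε^{−1}·Σ_i‖(D^ε_B(1.16)_{n,n′}dip^B_{⟨x′,ν⟩}e_i)(⟨x,μ⟩)‖ ≤ mixC(n+n′)·(L^kε)^{n+n′}·((L^kε)^d)^{−1}·exp(−δ^mix_{n+n′−1}|x−x′|/L^k)` —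
p40's binder `hM` of FILE 5(a) with the explicit constant `mixC` and the rate `δ^mix_J = δ₁/(4L)^{J+2}` (`mixRate_eq`): the `D^ε_B`-row of
the final state has exponent `n + n′`, and p33's `majorant_le_top` needs exactly `n + n′ > d` (p35's count for `hM`: `n + n′ ≥ 4` in
`d = 3`).  `mixC_nonneg`, `mixRate_pos_le` for the assembly.

## Honest scope

Torus `Ω = T_ε` only; every `(n, n′)` with `n + n′ > d` (the (2.5) assembly uses `n, n′ ≥ 1` because of the Hölder member).  HYPOTHESES = those of the mixed seed: the (2.10) bounds of `G_k(T,B)`, `G_k(T,A+B)` in r15's shape `Ineq210 δ₁ C` on r14's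
torus carrier (same cube parameter `K₀` for both) and the twice-differentiated per-piece (2.10) in the shape of the conclusion of p33's
`ineq210_mixed_regularRegion_univ` with a constant `C_M` (all discharged on `T_ε` by r14's `ineq210_regularRegion_univ_small` and p33's
theorem for small regular backgrounds — not re-proved here), `|A_b| ≤ s`, `A` (I.2.23)-regular with `δ_A`, `(L^kε)|e|s ≤ 1`,
`0 < δ₁ ≤ 1`, `m² > 0`, `a > 0`, `1 ≤ k ≤ K`, every `d ≥ 1`, `L ≥ 2`, `N`.  Constants explicit, not optimized (`mixC` carries
`ε^{−d−1}·#Ix` against the `ε^{d+1}` inside `cvW/cdW`; the coupling powers `(|e|s + L^k|e|δ_A + …)^{n+n′}` live in p35's recursion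
`seqC`, as declared in 4β₂'s scope — the reading of print's `O(1)(e(L^kε)…)^{n+n′}`).  Six concrete real-constant `def`s (`dipRate`,
`cvW`, `cdW`, `cvDip`, `cdDip`, `mixC`); no `def … : Prop`, no new named fact; no `sorry`; axioms standard.  Value = the located
dipole–dipole entry of a by-reference estimate of B3, NOT summit progress.
-/

noncomputable section

open scoped BigOperators

namespace Literature.MathematicalPhysics.QuantumFieldTheory.Balaban1983to89.B3Op116MixedKernelRegularTorus

open HiggsLattice (ChargeData ScalarField covDeriv)
open HiggsCovariance (propagatorK E)
open B1Eq230FluctCov (Ix cb)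
open B1Ineq234Concrete (nCol)
open B3Ineq210RegularRegion (regRegionKernels)
open B3Op116SourceForm (srcV opV_apply_eq_srcV covDerivAt covDerivAt_apply)
open B3Op116MajorantStep (maj maj_nonneg maj_rate_mono maj_const_mono maj_add maj_exponent_reduce)
open B3Op116MajorantConvolution (majorant_le_top)
open B3Op116DKernelRegularTorus (seqC rateAt cvAt cdAt seqC_zero seqC_succ seqC_pos step_state state_op116_one_right
  state_op116_succ_right rateAt_closed rateAt_pos_le mesh_rpow_split rate_div_eq cK1 kap4)
open B3Op116MixedSeed (seedK1 seedK2 kC gE mixed_seed_state)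
open B3Eq116TwoSidedExpansion (op116 opV eq344_model eq344_model_right)
open B3Ineq210MixedRegularTorus (dip onb norm_onb)

variable {P : HiggsLattice.Params} {N : ℕ}

/-! ## §1 The seed triples and their signs -/

section Constants

/-- the rate of the two inner dipole seeds: `δ₀/(4L)` with `δ₀ = δ₁/(4L)` the rate of the mixed seed, i.e. `δ₁/(4L)²`.
[cite: Balaban1983Higgs3, (2.10) p.426] -/
def dipRate (P : HiggsLattice.Params) (δ₁ : ℝ) : ℝ := δ₁ / 2 / 2 / P.L / 2 / P.L / 2

/-- the VALUE constant of the mixed seed `Wdip^B_{b′}Y` for a unit charge `‖Y‖ = 1` (p40 g73's `mixed_seed_state`, first clause).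
[cite: Balaban1983Higgs3, (1.16) p.414, (2.10) p.426] -/
def cvW (P : HiggsLattice.Params) (N : ℕ) (C : ChargeData N) (k : ℕ) (a δ₁ Cst CM s δA : ℝ) : ℝ :=
  P.mesh 0 * 1 * (Fintype.card (Ix N) : ℝ) *
    (|C.e| * s * seedK1 P N δ₁ Cst CM a 2 (P.mesh 0 ^ P.d * Cst) ((P.mesh 0 ^ P.d * Cst) * (1 + Real.exp 1))
      + (P.L : ℝ) ^ k * (|C.e| * δA) * seedK2 P N δ₁ Cst 2 (P.mesh 0 ^ P.d * Cst))

/-- the `D^ε_B`-ROW constant of the mixed seed `Wdip^B_{b′}Y` for a unit charge (p40 g73's `mixed_seed_state`, second clause).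
[cite: Balaban1983Higgs3, (1.16) p.414, (2.10) p.426] -/
def cdW (P : HiggsLattice.Params) (N : ℕ) (C : ChargeData N) (k : ℕ) (a δ₁ Cst CM s δA : ℝ) : ℝ :=
  |C.e| * s * seedK1 P N δ₁ Cst CM a 1 (P.mesh 0 * 1 * ((P.mesh 0 ^ P.d * Cst) * (1 + Real.exp 1)))
      (P.mesh 0 * 1 * (P.mesh 0 ^ P.d * CM + (P.mesh 0 ^ P.d * Cst) * Real.exp 1
        + (P.mesh 0 ^ P.d * Cst) * (1 + Real.exp 1) * Real.exp 1))
    + (P.L : ℝ) ^ k * (|C.e| * δA) * seedK2 P N δ₁ Cst 1 (P.mesh 0 * 1 * ((P.mesh 0 ^ P.d * Cst) * (1 + Real.exp 1)))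

/-- the VALUE constant of the two inner seeds `G_k(T,X)V_kG_k(T,B)dip^B_{b′}Y`: `cvW + L^kε·cvAt(1)` (one step of p35's recursion from
`(δ₁/(4L), cvW, cdW)`, one unit of exponent sold for `L^kε`). [cite: Balaban1983Higgs3, (1.16) p.414, (2.10) p.426] -/
def cvDip (P : HiggsLattice.Params) (N : ℕ) (C : ChargeData N) (k : ℕ) (a δ₁ Cst CM s δA : ℝ) : ℝ :=
  cvW P N C k a δ₁ Cst CM s δA
    + cvAt P N C k a Cst s δA (δ₁ / 2 / 2 / P.L) (cvW P N C k a δ₁ Cst CM s δA) (cdW P N C k a δ₁ Cst CM s δA) 1 * P.mesh k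

/-- the `D^ε_B`-ROW constant of the two inner seeds: `cdW + L^kε·cdAt(1)`. [cite: Balaban1983Higgs3, (1.16) p.414, (2.10) p.426] -/
def cdDip (P : HiggsLattice.Params) (N : ℕ) (C : ChargeData N) (k : ℕ) (a δ₁ Cst CM s δA : ℝ) : ℝ :=
  cdW P N C k a δ₁ Cst CM s δA
    + cdAt P N C k a Cst s δA (δ₁ / 2 / 2 / P.L) (cvW P N C k a δ₁ Cst CM s δA) (cdW P N C k a δ₁ Cst CM s δA) 1 * P.mesh k

/-- the constant of `kernel116_mixed_le`: `ε^{−d}·ε^{−1}·#Ix·cdAt^{dip}(M−1)/(L^{M−d} − 1)`. [cite: Balaban1983Higgs3, (1.16) p.414] -/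
def mixC (P : HiggsLattice.Params) (N : ℕ) (C : ChargeData N) (k : ℕ) (a δ₁ Cst CM s δA : ℝ) (M : ℕ) : ℝ :=
  (P.mesh 0 ^ P.d)⁻¹ * (P.mesh 0)⁻¹ * (Fintype.card (Ix N) : ℝ) *
    (cdAt P N C k a Cst s δA (dipRate P δ₁) (cvDip P N C k a δ₁ Cst CM s δA) (cdDip P N C k a δ₁ Cst CM s δA) (M - 1)
      / ((P.L : ℝ) ^ ((M : ℝ) - (P.d : ℝ)) - 1))

variable {C : ChargeData N} {k : ℕ} {a δ₁ Cst CM s δA : ℝ}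

/-- `L^e/(L^e − 1) > 0` for `L > 1`, `e > 0` (the geometric constant of the scale sums (2.6)). [cite: Balaban1983Higgs3, (2.6) p.424] -/
theorem gE_pos (hL1 : 1 < P.L) {e : ℝ} (he : 0 < e) : 0 < gE P e := by
  have hL : (1 : ℝ) < (P.L : ℝ) := by exact_mod_cast hL1
  have h1 : 1 < (P.L : ℝ) ^ e := Real.one_lt_rpow hL he
  unfold gE
  exact div_pos (by linarith) (by linarith)

/-- `N(8d/δ)^d ≥ 0` for `δ > 0` (the lattice-sum constant of (2.10)). [cite: Balaban1983Higgs3, (2.10) p.426] -/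
theorem kC_nonneg {δ : ℝ} (hδ : 0 < δ) : 0 ≤ kC P N δ := by
  unfold kC; positivity

/-- `K₂ ≥ 0`. [cite: Balaban1983Higgs3, (1.16) p.414] -/
theorem seedK2_nonneg (hL1 : 1 < P.L) (hδ₁ : 0 < δ₁) (hCst : 0 ≤ Cst) {aw cw : ℝ} (haw : 0 < aw) (hcw : 0 ≤ cw) :
    0 ≤ seedK2 P N δ₁ Cst aw cw := by
  have h1 := gE_pos (P := P) hL1 haw
  have h2 := gE_pos (P := P) hL1 one_pos
  have h3 := kC_nonneg (P := P) (N := N) hδ₁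
  unfold seedK2
  positivity

/-- `K₁ ≥ 0`. [cite: Balaban1983Higgs3, (1.16) p.414] -/
theorem seedK1_nonneg (hL1 : 1 < P.L) (hδ₁ : 0 < δ₁) (hCst : 0 ≤ Cst) (hCM : 0 ≤ CM) (ha : 0 ≤ a) {aw cw cw' : ℝ}
    (haw : 0 < aw) (hcw : 0 ≤ cw) (hcw' : 0 ≤ cw') : 0 ≤ seedK1 P N δ₁ Cst CM a aw cw cw' := by
  have hL : (1 : ℝ) < (P.L : ℝ) := by exact_mod_cast hL1
  have h1 := gE_pos (P := P) hL1 haw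
  have h2 := gE_pos (P := P) hL1 one_pos
  have h3 := kC_nonneg (P := P) (N := N) hδ₁
  have h4 := kC_nonneg (P := P) (N := N) (half_pos hδ₁)
  have h5 : 0 < (P.L : ℝ) ^ aw - 1 := by have := Real.one_lt_rpow hL haw; linarith
  have h6 : 0 ≤ (P.L : ℝ) ^ (aw - (P.d : ℝ)) := Real.rpow_nonneg (by positivity) _
  unfold seedK1
  positivity

/-- `cvW ≥ 0`. [cite: Balaban1983Higgs3, (1.16) p.414] -/
theorem cvW_nonneg (hL1 : 1 < P.L) (hδ₁ : 0 < δ₁) (hCst : 0 ≤ Cst) (hCM : 0 ≤ CM) (ha : 0 ≤ a) (hs : 0 ≤ s) (hδA : 0 ≤ δA) :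
    0 ≤ cvW P N C k a δ₁ Cst CM s δA := by
  have hε := P.mesh_pos 0
  have h1 := seedK1_nonneg (P := P) (N := N) hL1 hδ₁ hCst hCM ha two_pos (by positivity : 0 ≤ P.mesh 0 ^ P.d * Cst)
    (by positivity : 0 ≤ (P.mesh 0 ^ P.d * Cst) * (1 + Real.exp 1))
  have h2 := seedK2_nonneg (P := P) (N := N) hL1 hδ₁ hCst two_pos (by positivity : 0 ≤ P.mesh 0 ^ P.d * Cst)
  unfold cvW
  positivity

/-- `cdW ≥ 0`. [cite: Balaban1983Higgs3, (1.16) p.414] -/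
theorem cdW_nonneg (hL1 : 1 < P.L) (hδ₁ : 0 < δ₁) (hCst : 0 ≤ Cst) (hCM : 0 ≤ CM) (ha : 0 ≤ a) (hs : 0 ≤ s) (hδA : 0 ≤ δA) :
    0 ≤ cdW P N C k a δ₁ Cst CM s δA := by
  have hε := P.mesh_pos 0
  have hcw : 0 ≤ P.mesh 0 * 1 * ((P.mesh 0 ^ P.d * Cst) * (1 + Real.exp 1)) := by positivity
  have hcw' : 0 ≤ P.mesh 0 * 1 * (P.mesh 0 ^ P.d * CM + (P.mesh 0 ^ P.d * Cst) * Real.exp 1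
      + (P.mesh 0 ^ P.d * Cst) * (1 + Real.exp 1) * Real.exp 1) := by positivity
  have h1 := seedK1_nonneg (P := P) (N := N) hL1 hδ₁ hCst hCM ha one_pos hcw hcw'
  have h2 := seedK2_nonneg (P := P) (N := N) hL1 hδ₁ hCst one_pos hcw
  unfold cdW
  positivity

/-- `0 < δ₁/(4L) ≤ δ₁` and `0 < δ₁/(4L)² ≤ δ₁` (`δ₁ > 0`, `L ≥ 1`). [cite: Balaban1983Higgs3, (2.10) p.426] -/
theorem seedRate_pos_le (hδ₁ : 0 < δ₁) :
    0 < δ₁ / 2 / 2 / P.L ∧ δ₁ / 2 / 2 / P.L ≤ δ₁ ∧ 0 < dipRate P δ₁ ∧ dipRate P δ₁ ≤ δ₁ / 2 / 2 / P.L := by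
  have hL : (1 : ℝ) ≤ (P.L : ℝ) := by exact_mod_cast P.hL
  have hL0 : (0 : ℝ) < (P.L : ℝ) := by linarith
  have h4 : (1 : ℝ) ≤ 4 * (P.L : ℝ) := by linarith
  have key : ∀ q : ℝ, 0 < q → q / 2 / 2 / P.L ≤ q ∧ q / 2 / P.L / 2 ≤ q := by
    intro q hq
    have e1 : q / 2 / 2 / P.L = q / (4 * P.L) := by ring
    have e2 : q / 2 / P.L / 2 = q / (4 * P.L) := by ring
    have h : q / (4 * P.L) ≤ q := by
      rw [div_le_iff₀ (by positivity)]; exact le_mul_of_one_le_right hq.le h4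
    exact ⟨by rw [e1]; exact h, by rw [e2]; exact h⟩
  have hq : 0 < δ₁ / 2 / 2 / P.L := by positivity
  refine ⟨hq, (key δ₁ hδ₁).1, by unfold dipRate; positivity, ?_⟩
  exact (key _ hq).2

/-- closed form: `dipRate = δ₁/(4L)²`. [cite: Balaban1983Higgs3, (2.10) p.426] -/
theorem dipRate_eq (δ₁ : ℝ) : dipRate P δ₁ = δ₁ / (4 * (P.L : ℝ)) ^ 2 := by
  have hL : (P.L : ℝ) ≠ 0 := by have := P.hL; positivity
  unfold dipRate
  field_simp
  ring

/-- `dipRate = (δ₁/(4L))/2/L/2` — one step of p35's rate recursion from the mixed seed's rate. [cite: Balaban1983Higgs3, (2.10) p.426] -/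
theorem dipRate_eq_step (δ₁ : ℝ) : dipRate P δ₁ = δ₁ / 2 / 2 / P.L / 2 / P.L / 2 := rfl

/-- the signs of the weakened triple: `0 ≤ cvDip`, `0 ≤ cdDip` (and of the step constants). [cite: Balaban1983Higgs3, (1.16) p.414] -/
theorem cvDip_cdDip_nonneg (hL1 : 1 < P.L) (hδ₁ : 0 < δ₁) (hCst : 0 ≤ Cst) (hCM : 0 ≤ CM) (ha : 0 ≤ a) (hs : 0 ≤ s)
    (hδA : 0 ≤ δA) :
    cvW P N C k a δ₁ Cst CM s δA ≤ cvDip P N C k a δ₁ Cst CM s δA ∧ cdW P N C k a δ₁ Cst CM s δA ≤ cdDip P N C k a δ₁ Cst CM s δA ∧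
    0 ≤ cvDip P N C k a δ₁ Cst CM s δA ∧ 0 ≤ cdDip P N C k a δ₁ Cst CM s δA := by
  have hv := cvW_nonneg (P := P) (N := N) (C := C) (k := k) hL1 hδ₁ hCst hCM ha hs hδA
  have hd := cdW_nonneg (P := P) (N := N) (C := C) (k := k) hL1 hδ₁ hCst hCM ha hs hδA
  obtain ⟨hr0, hr1, -, -⟩ := seedRate_pos_le (P := P) hδ₁
  obtain ⟨-, -, h1, h2⟩ := seqC_pos (P := P) (N := N) (C := C) (k := k) (a := a) (Cst := Cst) (s := s) (δA := δA)
    (δ₀ := δ₁ / 2 / 2 / P.L) (cv₀ := cvW P N C k a δ₁ Cst CM s δA) (cd₀ := cdW P N C k a δ₁ Cst CM s δA)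
    hL1 hr0 hr1 hv hd hCst hs hδA 1
  have hm := (P.mesh_pos k).le
  unfold cvDip cdDip
  exact ⟨le_add_of_nonneg_right (mul_nonneg h1 hm), le_add_of_nonneg_right (mul_nonneg h2 hm),
    add_nonneg hv (mul_nonneg h1 hm), add_nonneg hd (mul_nonneg h2 hm)⟩

/-- the rate of the state `J` of the weakened triple in closed form: `δ^mix_J = δ₁/(4L)^{J+2}`. [cite: Balaban1983Higgs3, (2.10) p.426] -/
theorem mixRate_eq {cv cd : ℝ} (J : ℕ) :
    rateAt P N C k a Cst s δA (dipRate P δ₁) cv cd J = δ₁ / (4 * (P.L : ℝ)) ^ (J + 2) := by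
  rw [rateAt_closed, dipRate_eq]
  have hL : (P.L : ℝ) ≠ 0 := by have := P.hL; positivity
  field_simp
  ring

/-- `0 < δ^mix_J ≤ δ₁`. [cite: Balaban1983Higgs3, (2.10) p.426] -/
theorem mixRate_pos_le (hδ₁ : 0 < δ₁) {cv cd : ℝ} (J : ℕ) :
    0 < rateAt P N C k a Cst s δA (dipRate P δ₁) cv cd J ∧ rateAt P N C k a Cst s δA (dipRate P δ₁) cv cd J ≤ δ₁ := by
  obtain ⟨hr0, hr1, hd0, hd1⟩ := seedRate_pos_le (P := P) hδ₁
  obtain ⟨h1, h2⟩ := rateAt_pos_le (P := P) (N := N) (C := C) (k := k) (a := a) (Cst := Cst) (s := s) (δA := δA)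
    (cv₀ := cv) (cd₀ := cd) hd0 J
  exact ⟨h1, h2.trans (hd1.trans hr1)⟩

/-- `mixC(M) ≥ 0` above the threshold `d < M`. [cite: Balaban1983Higgs3, (1.16) p.414] -/
theorem mixC_nonneg (hL1 : 1 < P.L) (hδ₁ : 0 < δ₁) (hCst : 0 ≤ Cst) (hCM : 0 ≤ CM) (ha : 0 ≤ a) (hs : 0 ≤ s) (hδA : 0 ≤ δA)
    {M : ℕ} (hd : P.d < M) : 0 ≤ mixC P N C k a δ₁ Cst CM s δA M := by
  have hL : (1 : ℝ) < (P.L : ℝ) := by exact_mod_cast hL1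
  obtain ⟨-, -, hv, hdd⟩ := cvDip_cdDip_nonneg (P := P) (N := N) (C := C) (k := k) hL1 hδ₁ hCst hCM ha hs hδA
  obtain ⟨hr0, hr1, hd0, hd1⟩ := seedRate_pos_le (P := P) hδ₁
  obtain ⟨-, -, -, hcd⟩ := seqC_pos (P := P) (N := N) (C := C) (k := k) (a := a) (Cst := Cst) (s := s) (δA := δA)
    (δ₀ := dipRate P δ₁) (cv₀ := cvDip P N C k a δ₁ Cst CM s δA) (cd₀ := cdDip P N C k a δ₁ Cst CM s δA)
    hL1 hd0 (hd1.trans hr1) hv hdd hCst hs hδA (M - 1)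
  have hdM : (P.d : ℝ) < (M : ℝ) := by exact_mod_cast hd
  have hpow : 1 < (P.L : ℝ) ^ ((M : ℝ) - (P.d : ℝ)) := Real.one_lt_rpow hL (by linarith)
  have hε : 0 ≤ (P.mesh 0 ^ P.d)⁻¹ := inv_nonneg.mpr (pow_nonneg (P.mesh_pos 0).le _)
  have hε' : 0 ≤ (P.mesh 0)⁻¹ := inv_nonneg.mpr (P.mesh_pos 0).le
  unfold mixC
  exact mul_nonneg (mul_nonneg (mul_nonneg hε hε') (Nat.cast_nonneg _)) (div_nonneg hcd (by linarith))

end Constants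

/-! ## §2 The two inner seeds `G_k(T,X)V_kG_k(T,B)dip^B_{b′}Y`, `X ∈ {B, A+B}`, in the state `0` of the weakened triple -/

section Seeds

variable {C : ChargeData N} {A B : HiggsLattice.VecField P 0} {msq a : ℝ} {k K₀ : ℕ} {hL1 : 1 < P.L} {δ₁ Cst CM s δA : ℝ}

/-- **(I.3.44) read from the left gives the second seed algebraically: `G_k(T,B)V_kG_k(T,B) = W − G_k(T,B)V_kW`** (`W = G_k(T,B)V_kG_k(T,A+B)`,
p40 g70's `eq344_model`; `V_k` linear). [cite: Balaban1982Higgs1, (3.44) p.619] [cite: Balaban1983Higgs3, (1.16) p.414] -/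
theorem GB_srcV_GB_eq (hL : 1 < P.L) (hmsq : 0 < msq) (ha : 0 < a) (hk : 1 ≤ k) (ψ : ScalarField P 0 N) :
    propagatorK C Finset.univ B msq a k (srcV C A B k Finset.univ a (propagatorK C Finset.univ B msq a k ψ))
      = (propagatorK C Finset.univ (A + B) msq a k - propagatorK C Finset.univ B msq a k) ψ
        - propagatorK C Finset.univ B msq a k (srcV C A B k Finset.univ a
            ((propagatorK C Finset.univ (A + B) msq a k - propagatorK C Finset.univ B msq a k) ψ)) := by
  have hL1' : (1 : ℝ) < (P.L : ℝ) := by exact_mod_cast hL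
  have hak : 0 ≤ B1.aSeq a P.L k := (B1.aSeq_pos ha hL1' hk).le
  have h := congrArg (fun T : Module.End ℝ (ScalarField P 0 N) => T ψ) (eq344_model C Finset.univ A B a k hmsq hak)
  simp only [LinearMap.add_apply, Module.End.mul_apply] at h
  -- `W ψ = G_B V_k (G_{A+B} ψ)` ((I.3.44)): `G_B(opV(G_{A+B}ψ)) = G_{A+B}ψ − G_Bψ`
  have key : propagatorK C Finset.univ B msq a k (opV C Finset.univ A B msq a k (propagatorK C Finset.univ (A + B) msq a k ψ))
      = propagatorK C Finset.univ (A + B) msq a k ψ - propagatorK C Finset.univ B msq a k ψ := by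
    rw [eq_sub_iff_add_eq']; exact h.symm
  rw [← opV_apply_eq_srcV C A B msq, ← opV_apply_eq_srcV C A B msq, LinearMap.sub_apply, map_sub, map_sub, key]
  abel

variable (hδ₁ : 0 < δ₁) (hδ₁1 : δ₁ ≤ 1) (hCst : 0 ≤ Cst) (hCM : 0 ≤ CM)
  (h210B : (regRegionKernels hL1 C Finset.univ B msq a k K₀).Ineq210 δ₁ Cst)
  (hmixB : ∀ (j : ℕ) (μ ν : Fin P.d) (x x' : HiggsLattice.Site P 0),
    B3Ineq210MixedRegularRegion.mixedTermR C Finset.univ B msq a k j μ ν x x'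
      ≤ CM * (P.mesh j ^ P.d)⁻¹ * Real.exp (-(δ₁ * ((HiggsLattice.Site.tdist x x' : ℝ) / (P.L : ℝ) ^ j))))
  (h210AB : (regRegionKernels hL1 C Finset.univ (A + B) msq a k K₀).Ineq210 δ₁ Cst)
  (hmixAB : ∀ (j : ℕ) (μ ν : Fin P.d) (x x' : HiggsLattice.Site P 0),
    B3Ineq210MixedRegularRegion.mixedTermR C Finset.univ (A + B) msq a k j μ ν x x'
      ≤ CM * (P.mesh j ^ P.d)⁻¹ * Real.exp (-(δ₁ * ((HiggsLattice.Site.tdist x x' : ℝ) / (P.L : ℝ) ^ j))))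
  (hmsq : 0 < msq) (ha : 0 < a) (hk : 1 ≤ k) (hkK : k ≤ P.K) (i₀ : Ix N)
  (hs : 0 ≤ s) (hA : ∀ b : HiggsLattice.PBond P 0, |A b| ≤ s) (hδA : 0 ≤ δA)
  (hregA : ∀ (z : HiggsLattice.Site P 0) (μ ν : Fin P.d), |A ⟨z.shift ν, μ⟩ - A ⟨z, μ⟩| ≤ δA)
  (ht1 : P.mesh k * (|C.e| * s) ≤ 1)
include hδ₁ hδ₁1 hCst hCM h210B hmixB h210AB hmixAB hmsq ha hk hkK i₀ hs hA hδA hregA ht1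

/-- **The mixed seed for a unit charge**: `Wdip^B_{b′}e_i` is in the state `0` of `(δ₁/(4L), cvW, cdW)` (p40 g73's `mixed_seed_state`,
`‖e_i‖ = 1`). [cite: Balaban1983Higgs3, (1.16) p.414, (2.10) p.426] [cite: Balaban1982Higgs1, (3.44) p.619] -/
theorem W_dip_state (b' : HiggsLattice.PBond P 0) (i : Ix N) :
    (∀ y, ‖(propagatorK C Finset.univ (A + B) msq a k - propagatorK C Finset.univ B msq a k) (dip C B b' (onb N i)) y‖
        ≤ maj P k (cvW P N C k a δ₁ Cst CM s δA) 2 (δ₁ / 2 / 2 / P.L) y b'.src) ∧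
    (∀ b₀, ‖covDeriv C B ((propagatorK C Finset.univ (A + B) msq a k - propagatorK C Finset.univ B msq a k) (dip C B b' (onb N i))) b₀‖
        ≤ maj P k (cdW P N C k a δ₁ Cst CM s δA) 1 (δ₁ / 2 / 2 / P.L) b₀.src b'.src) := by
  have h := mixed_seed_state hmsq ha hk hkK hδ₁ hδ₁1 hCst hCM hs hδA ht1 h210B hmixB h210AB hmixAB hA hregA i₀ b' (onb N i)
  rw [norm_onb] at h
  exact h

/-- **`G_k(T,B)V_k(Wdip^B_{b′}e_i)` is in the state `1` of `(δ₁/(4L), cvW, cdW)`, read at exponents `(2, 1)`**: values below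
`𝔪_k(L^kε·cvAt(1), 2; dipRate)`, `D^ε_B`-rows below `𝔪_k(L^kε·cdAt(1), 1; dipRate)` (p35's `step_state` + `maj_exponent_reduce`).
[cite: Balaban1983Higgs3, (1.16) p.414, (2.10) p.426] -/
theorem GB_srcV_W_dip_bound (b' : HiggsLattice.PBond P 0) (i : Ix N) :
    (∀ y, ‖propagatorK C Finset.univ B msq a k (srcV C A B k Finset.univ a
          ((propagatorK C Finset.univ (A + B) msq a k - propagatorK C Finset.univ B msq a k) (dip C B b' (onb N i)))) y‖
        ≤ maj P k (cvAt P N C k a Cst s δA (δ₁ / 2 / 2 / P.L) (cvW P N C k a δ₁ Cst CM s δA) (cdW P N C k a δ₁ Cst CM s δA) 1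
            * P.mesh k) 2 (dipRate P δ₁) y b'.src) ∧
    (∀ b₀, ‖covDeriv C B (propagatorK C Finset.univ B msq a k (srcV C A B k Finset.univ a
          ((propagatorK C Finset.univ (A + B) msq a k - propagatorK C Finset.univ B msq a k) (dip C B b' (onb N i))))) b₀‖
        ≤ maj P k (cdAt P N C k a Cst s δA (δ₁ / 2 / 2 / P.L) (cvW P N C k a δ₁ Cst CM s δA) (cdW P N C k a δ₁ Cst CM s δA) 1
            * P.mesh k) 1 (dipRate P δ₁) b₀.src b'.src) := by
  have hL : 1 < P.L := hL1
  have hv := cvW_nonneg (P := P) (N := N) (C := C) (k := k) hL hδ₁ hCst hCM ha.le hs hδA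
  have hd := cdW_nonneg (P := P) (N := N) (C := C) (k := k) hL hδ₁ hCst hCM ha.le hs hδA
  obtain ⟨hr0, hr1, -, -⟩ := seedRate_pos_le (P := P) hδ₁
  obtain ⟨hW1, hW2⟩ := W_dip_state hδ₁ hδ₁1 hCst hCM h210B hmixB h210AB hmixAB hmsq ha hk hkK i₀ hs hA hδA hregA ht1 b' i
  set cv₀ := cvW P N C k a δ₁ Cst CM s δA
  set cd₀ := cdW P N C k a δ₁ Cst CM s δA
  set φ := (propagatorK C Finset.univ (A + B) msq a k - propagatorK C Finset.univ B msq a k) (dip C B b' (onb N i))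
  obtain ⟨e1, e2, e3⟩ := seqC_zero (P := P) (N := N) (C := C) (k := k) (a := a) (Cst := Cst) (s := s) (δA := δA)
    (δ₀ := δ₁ / 2 / 2 / P.L) (cv₀ := cv₀) (cd₀ := cd₀)
  have hV0 : ∀ y, ‖φ y‖ ≤ maj P k (cvAt P N C k a Cst s δA (δ₁ / 2 / 2 / P.L) cv₀ cd₀ 0) (2 + ((0 : ℕ) : ℝ))
      (rateAt P N C k a Cst s δA (δ₁ / 2 / 2 / P.L) cv₀ cd₀ 0) y b'.src := by
    intro y; rw [e1, e2, Nat.cast_zero, add_zero]; exact hW1 y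
  have hD0 : ∀ b₀, ‖covDeriv C B φ b₀‖ ≤ maj P k (cdAt P N C k a Cst s δA (δ₁ / 2 / 2 / P.L) cv₀ cd₀ 0) (1 + ((0 : ℕ) : ℝ))
      (rateAt P N C k a Cst s δA (δ₁ / 2 / 2 / P.L) cv₀ cd₀ 0) b₀.src b'.src := by
    intro b₀; rw [e1, e3, Nat.cast_zero, add_zero]; exact hW2 b₀
  obtain ⟨hv1, hd1⟩ := step_state hδ₁ hδ₁1 hCst h210B h210AB hmsq ha hk hkK i₀ hs hA hδA hregA hr0 hr1 hv hd b'.src 0 φ hV0 hD0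
    B (Or.inl rfl)
  obtain ⟨f1, -, -⟩ := seqC_succ (P := P) (N := N) (C := C) (k := k) (a := a) (Cst := Cst) (s := s) (δA := δA)
    (δ₀ := δ₁ / 2 / 2 / P.L) (cv₀ := cv₀) (cd₀ := cd₀) 0
  have hrate : rateAt P N C k a Cst s δA (δ₁ / 2 / 2 / P.L) cv₀ cd₀ (0 + 1) = dipRate P δ₁ := by
    rw [f1, e1]; rfl
  obtain ⟨-, -, hcv1, hcd1⟩ := seqC_pos (P := P) (N := N) (C := C) (k := k) (a := a) (Cst := Cst) (s := s) (δA := δA)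
    (δ₀ := δ₁ / 2 / 2 / P.L) (cv₀ := cv₀) (cd₀ := cd₀) hL hr0 hr1 hv hd hCst hs hδA (0 + 1)
  constructor
  · intro y
    have h := (hv1 y).trans (maj_exponent_reduce hcv1 y b'.src)
    rw [hrate, show (2 : ℝ) + ((0 + 1 : ℕ) : ℝ) - 1 = 2 by push_cast; ring] at h
    exact h
  · intro b₀
    have h := (hd1 b₀).trans (maj_exponent_reduce hcd1 b₀.src b'.src)
    rw [hrate, show (1 : ℝ) + ((0 + 1 : ℕ) : ℝ) - 1 = 1 by push_cast; ring] at h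
    exact h

/-- **The seed `Wdip^B_{b′}e_i` in the state `0` of the WEAKENED triple `(dipRate, cvDip, cdDip)`** (rate and constants monotone).
[cite: Balaban1983Higgs3, (1.16) p.414, (2.10) p.426] -/
theorem W_dip_state_weak (b' : HiggsLattice.PBond P 0) (i : Ix N) :
    (∀ y, ‖(propagatorK C Finset.univ (A + B) msq a k - propagatorK C Finset.univ B msq a k) (dip C B b' (onb N i)) y‖
        ≤ maj P k (cvAt P N C k a Cst s δA (dipRate P δ₁) (cvDip P N C k a δ₁ Cst CM s δA) (cdDip P N C k a δ₁ Cst CM s δA) 0)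
            (2 + ((0 : ℕ) : ℝ))
            (rateAt P N C k a Cst s δA (dipRate P δ₁) (cvDip P N C k a δ₁ Cst CM s δA) (cdDip P N C k a δ₁ Cst CM s δA) 0)
            y b'.src) ∧
    (∀ b₀, ‖covDeriv C B ((propagatorK C Finset.univ (A + B) msq a k - propagatorK C Finset.univ B msq a k) (dip C B b' (onb N i))) b₀‖
        ≤ maj P k (cdAt P N C k a Cst s δA (dipRate P δ₁) (cvDip P N C k a δ₁ Cst CM s δA) (cdDip P N C k a δ₁ Cst CM s δA) 0)
            (1 + ((0 : ℕ) : ℝ))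
            (rateAt P N C k a Cst s δA (dipRate P δ₁) (cvDip P N C k a δ₁ Cst CM s δA) (cdDip P N C k a δ₁ Cst CM s δA) 0)
            b₀.src b'.src) := by
  have hL : 1 < P.L := hL1
  obtain ⟨e1, e2, e3⟩ := seqC_zero (P := P) (N := N) (C := C) (k := k) (a := a) (Cst := Cst) (s := s) (δA := δA)
    (δ₀ := dipRate P δ₁) (cv₀ := cvDip P N C k a δ₁ Cst CM s δA) (cd₀ := cdDip P N C k a δ₁ Cst CM s δA)
  rw [e1, e2, e3, Nat.cast_zero, add_zero, add_zero]
  have hv := cvW_nonneg (P := P) (N := N) (C := C) (k := k) hL hδ₁ hCst hCM ha.le hs hδA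
  have hd := cdW_nonneg (P := P) (N := N) (C := C) (k := k) hL hδ₁ hCst hCM ha.le hs hδA
  obtain ⟨-, -, -, hd1⟩ := seedRate_pos_le (P := P) hδ₁
  obtain ⟨hW1, hW2⟩ := W_dip_state hδ₁ hδ₁1 hCst hCM h210B hmixB h210AB hmixAB hmsq ha hk hkK i₀ hs hA hδA hregA ht1 b' i
  obtain ⟨hle1, hle2, -, -⟩ := cvDip_cdDip_nonneg (P := P) (N := N) (C := C) (k := k) hL hδ₁ hCst hCM ha.le hs hδA
  exact ⟨fun y => ((hW1 y).trans (maj_rate_mono hv hd1 y b'.src)).trans (maj_const_mono hle1 y b'.src),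
    fun b₀ => ((hW2 b₀).trans (maj_rate_mono hd hd1 b₀.src b'.src)).trans (maj_const_mono hle2 b₀.src b'.src)⟩

/-- **BOTH INNER SEEDS `G_k(T,X)V_kG_k(T,B)dip^B_{b′}e_i`, `X ∈ {B, A+B}`, ARE IN THE STATE `0` OF THE WEAKENED TRIPLE
`(dipRate, cvDip, cdDip)`**: `X = A + B` is `W` itself ((I.3.44) from the right), `X = B` is `W − G_k(T,B)V_kW` (`GB_srcV_GB_eq`) — no second
Calderón–Zygmund computation. [cite: Balaban1983Higgs3, (1.16) p.414, (2.10) p.426] [cite: Balaban1982Higgs1, (3.44) p.619] -/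
theorem seed_state (b' : HiggsLattice.PBond P 0) (i : Ix N) (X : HiggsLattice.VecField P 0) (hX : X = B ∨ X = A + B) :
    (∀ y, ‖propagatorK C Finset.univ X msq a k (srcV C A B k Finset.univ a
          (propagatorK C Finset.univ B msq a k (dip C B b' (onb N i)))) y‖
        ≤ maj P k (cvAt P N C k a Cst s δA (dipRate P δ₁) (cvDip P N C k a δ₁ Cst CM s δA) (cdDip P N C k a δ₁ Cst CM s δA) 0)
            (2 + ((0 : ℕ) : ℝ))
            (rateAt P N C k a Cst s δA (dipRate P δ₁) (cvDip P N C k a δ₁ Cst CM s δA) (cdDip P N C k a δ₁ Cst CM s δA) 0)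
            y b'.src) ∧
    (∀ b₀, ‖covDeriv C B (propagatorK C Finset.univ X msq a k (srcV C A B k Finset.univ a
          (propagatorK C Finset.univ B msq a k (dip C B b' (onb N i))))) b₀‖
        ≤ maj P k (cdAt P N C k a Cst s δA (dipRate P δ₁) (cvDip P N C k a δ₁ Cst CM s δA) (cdDip P N C k a δ₁ Cst CM s δA) 0)
            (1 + ((0 : ℕ) : ℝ))
            (rateAt P N C k a Cst s δA (dipRate P δ₁) (cvDip P N C k a δ₁ Cst CM s δA) (cdDip P N C k a δ₁ Cst CM s δA) 0)
            b₀.src b'.src) := by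
  have hL : 1 < P.L := hL1
  obtain ⟨e1, e2, e3⟩ := seqC_zero (P := P) (N := N) (C := C) (k := k) (a := a) (Cst := Cst) (s := s) (δA := δA)
    (δ₀ := dipRate P δ₁) (cv₀ := cvDip P N C k a δ₁ Cst CM s δA) (cd₀ := cdDip P N C k a δ₁ Cst CM s δA)
  rw [e1, e2, e3, Nat.cast_zero, add_zero, add_zero]
  have hv := cvW_nonneg (P := P) (N := N) (C := C) (k := k) hL hδ₁ hCst hCM ha.le hs hδA
  have hd := cdW_nonneg (P := P) (N := N) (C := C) (k := k) hL hδ₁ hCst hCM ha.le hs hδA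
  obtain ⟨-, -, hd0, hd1⟩ := seedRate_pos_le (P := P) hδ₁
  obtain ⟨hW1, hW2⟩ := W_dip_state hδ₁ hδ₁1 hCst hCM h210B hmixB h210AB hmixAB hmsq ha hk hkK i₀ hs hA hδA hregA ht1 b' i
  obtain ⟨hG1, hG2⟩ := GB_srcV_W_dip_bound hδ₁ hδ₁1 hCst hCM h210B hmixB h210AB hmixAB hmsq ha hk hkK i₀ hs hA hδA hregA ht1 b' i
  -- `W dip` in the state 0 of the weakened triple
  have hW1' : ∀ y, ‖(propagatorK C Finset.univ (A + B) msq a k - propagatorK C Finset.univ B msq a k) (dip C B b' (onb N i)) y‖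
      ≤ maj P k (cvW P N C k a δ₁ Cst CM s δA) 2 (dipRate P δ₁) y b'.src :=
    fun y => (hW1 y).trans (maj_rate_mono hv hd1 y b'.src)
  have hW2' : ∀ b₀, ‖covDeriv C B ((propagatorK C Finset.univ (A + B) msq a k - propagatorK C Finset.univ B msq a k)
      (dip C B b' (onb N i))) b₀‖ ≤ maj P k (cdW P N C k a δ₁ Cst CM s δA) 1 (dipRate P δ₁) b₀.src b'.src :=
    fun b₀ => (hW2 b₀).trans (maj_rate_mono hd hd1 b₀.src b'.src)
  obtain ⟨hle1, hle2, -, -⟩ := cvDip_cdDip_nonneg (P := P) (N := N) (C := C) (k := k) hL hδ₁ hCst hCM ha.le hs hδA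
  -- (I.3.44) read from the right: `G_k(T,A+B)V_kG_k(T,B) = W` (p40 g70's `eq344_model_right`, r14's THEOREM A; = p35's v1.4
  -- `W_apply_eq_op116_zero_one` unfolded)
  have hGAB : ∀ ψ : ScalarField P 0 N,
      propagatorK C Finset.univ (A + B) msq a k (srcV C A B k Finset.univ a (propagatorK C Finset.univ B msq a k ψ))
        = (propagatorK C Finset.univ (A + B) msq a k - propagatorK C Finset.univ B msq a k) ψ := by
    intro ψ
    have hL1' : (1 : ℝ) < (P.L : ℝ) := by exact_mod_cast hL
    have hak : 0 ≤ B1.aSeq a P.L k := (B1.aSeq_pos ha hL1' hk).le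
    have h := congrArg (fun T : Module.End ℝ (ScalarField P 0 N) => T ψ) (eq344_model_right C Finset.univ A B a k hmsq hak)
    simp only [LinearMap.add_apply, Module.End.mul_apply, opV_apply_eq_srcV] at h
    rw [LinearMap.sub_apply, h]
    abel
  rcases hX with rfl | rfl
  · -- X = B: `G_BV_kG_Bdip = Wdip − G_BV_k(Wdip)`
    constructor
    · intro y
      rw [GB_srcV_GB_eq hL hmsq ha hk, Pi.sub_apply]
      refine (norm_sub_le _ _).trans ?_
      refine (add_le_add (hW1' y) (hG1 y)).trans (le_of_eq ?_)
      rw [maj_add]; rfl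
    · intro b₀
      rw [GB_srcV_GB_eq hL hmsq ha hk, ← covDerivAt_apply, map_sub, covDerivAt_apply, covDerivAt_apply]
      refine (norm_sub_le _ _).trans ?_
      refine (add_le_add (hW2' b₀) (hG2 b₀)).trans (le_of_eq ?_)
      rw [maj_add]; rfl
  · -- X = A + B: `G_{A+B}V_kG_Bdip = Wdip`
    constructor
    · intro y
      rw [hGAB]
      exact (hW1' y).trans (maj_const_mono hle1 y b'.src)
    · intro b₀
      rw [hGAB]
      exact (hW2' b₀).trans (maj_const_mono hle2 b₀.src b'.src)

/-! ## §3 The state of `(1.16)_{n,n′}dip^B_{b′}e_i` for `n + n′ ≥ 1` -/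

/-- **`(1.16)_{n,n″+1}dip^B_{b′}e_i` IS IN THE STATE `n + n″` OF THE WEAKENED TRIPLE** — p35's v1.2 entry points: `n″ + 1 ≥ 2` through
`state_op116_succ_right` on the two inner seeds (`seed_state`), `n″ + 1 = 1` through `state_op116_one_right` on the seed `W`
(`seed_state` at `X = A + B`). [cite: Balaban1983Higgs3, (1.16) p.414, (2.10) p.426] -/
theorem dip_state (n n'' : ℕ) (b' : HiggsLattice.PBond P 0) (i : Ix N) :
    (∀ y, ‖op116 C Finset.univ A B msq a k n (n'' + 1) (dip C B b' (onb N i)) y‖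
        ≤ maj P k (cvAt P N C k a Cst s δA (dipRate P δ₁) (cvDip P N C k a δ₁ Cst CM s δA) (cdDip P N C k a δ₁ Cst CM s δA) (n + n''))
            (2 + (((n + n'') : ℕ) : ℝ))
            (rateAt P N C k a Cst s δA (dipRate P δ₁) (cvDip P N C k a δ₁ Cst CM s δA) (cdDip P N C k a δ₁ Cst CM s δA) (n + n''))
            y b'.src) ∧
    (∀ b₀, ‖covDeriv C B (op116 C Finset.univ A B msq a k n (n'' + 1) (dip C B b' (onb N i))) b₀‖
        ≤ maj P k (cdAt P N C k a Cst s δA (dipRate P δ₁) (cvDip P N C k a δ₁ Cst CM s δA) (cdDip P N C k a δ₁ Cst CM s δA) (n + n''))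
            (1 + (((n + n'') : ℕ) : ℝ))
            (rateAt P N C k a Cst s δA (dipRate P δ₁) (cvDip P N C k a δ₁ Cst CM s δA) (cdDip P N C k a δ₁ Cst CM s δA) (n + n''))
            b₀.src b'.src) := by
  have hL : 1 < P.L := hL1
  obtain ⟨-, -, hv, hd⟩ := cvDip_cdDip_nonneg (P := P) (N := N) (C := C) (k := k) hL hδ₁ hCst hCM ha.le hs hδA
  obtain ⟨hr0, hr1, hd0, hd1⟩ := seedRate_pos_le (P := P) hδ₁
  have hdδ : dipRate P δ₁ ≤ δ₁ := hd1.trans hr1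
  cases n'' with
  | zero =>
    have hW := seed_state hδ₁ hδ₁1 hCst hCM h210B hmixB h210AB hmixAB hmsq ha hk hkK i₀ hs hA hδA hregA ht1 b' i (A + B) (Or.inr rfl)
    have h := state_op116_one_right hδ₁ hδ₁1 hCst h210B h210AB hmsq ha hk hkK i₀ hs hA hδA hregA hd0 hdδ hv hd b'.src n 0
      (dip C B b' (onb N i)) hW
    simp only [Nat.zero_add, Nat.add_zero] at h ⊢
    exact h
  | succ m =>
    have hVG := fun X hX =>
      seed_state hδ₁ hδ₁1 hCst hCM h210B hmixB h210AB hmixAB hmsq ha hk hkK i₀ hs hA hδA hregA ht1 b' i X hX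
    have h := state_op116_succ_right hδ₁ hδ₁1 hCst h210B h210AB hmsq ha hk hkK i₀ hs hA hδA hregA hd0 hdδ hv hd b'.src (m + 1) n 0
      (dip C B b' (onb N i)) hVG
    simp only [Nat.zero_add] at h
    exact h

/-- **`(1.16)_{m+1,0}dip^B_{b′}e_i` IS IN THE STATE `m` OF THE WEAKENED TRIPLE** — p35's v1.3 left iteration `state_op116_add_left`
from `(1.16)_{1,0}dip = Wdip` ((I.3.44) from the left; `W_dip_state_weak`). [cite: Balaban1983Higgs3, (1.16) p.414, (2.10) p.426] -/
theorem dip_state_zero_right (m : ℕ) (b' : HiggsLattice.PBond P 0) (i : Ix N) :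
    (∀ y, ‖op116 C Finset.univ A B msq a k (m + 1) 0 (dip C B b' (onb N i)) y‖
        ≤ maj P k (cvAt P N C k a Cst s δA (dipRate P δ₁) (cvDip P N C k a δ₁ Cst CM s δA) (cdDip P N C k a δ₁ Cst CM s δA) m)
            (2 + ((m : ℕ) : ℝ))
            (rateAt P N C k a Cst s δA (dipRate P δ₁) (cvDip P N C k a δ₁ Cst CM s δA) (cdDip P N C k a δ₁ Cst CM s δA) m)
            y b'.src) ∧
    (∀ b₀, ‖covDeriv C B (op116 C Finset.univ A B msq a k (m + 1) 0 (dip C B b' (onb N i))) b₀‖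
        ≤ maj P k (cdAt P N C k a Cst s δA (dipRate P δ₁) (cvDip P N C k a δ₁ Cst CM s δA) (cdDip P N C k a δ₁ Cst CM s δA) m)
            (1 + ((m : ℕ) : ℝ))
            (rateAt P N C k a Cst s δA (dipRate P δ₁) (cvDip P N C k a δ₁ Cst CM s δA) (cdDip P N C k a δ₁ Cst CM s δA) m)
            b₀.src b'.src) := by
  have hL : 1 < P.L := hL1
  obtain ⟨-, -, hv, hd⟩ := cvDip_cdDip_nonneg (P := P) (N := N) (C := C) (k := k) hL hδ₁ hCst hCM ha.le hs hδA
  obtain ⟨hr0, hr1, hd0, hd1⟩ := seedRate_pos_le (P := P) hδ₁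
  have hdδ : dipRate P δ₁ ≤ δ₁ := hd1.trans hr1
  have hW := W_dip_state_weak hδ₁ hδ₁1 hCst hCM h210B hmixB h210AB hmixAB hmsq ha hk hkK i₀ hs hA hδA hregA ht1 b' i
  -- `(1.16)_{1,0} = W` ((I.3.44) read from the left, p40 g70's `eq344_model`; = p35's v1.4 `W_apply_eq_op116_one_zero`)
  have h10 : ∀ ψ : ScalarField P 0 N, (propagatorK C Finset.univ (A + B) msq a k - propagatorK C Finset.univ B msq a k) ψ
      = op116 C Finset.univ A B msq a k 1 0 ψ := by
    intro ψ
    have hL1' : (1 : ℝ) < (P.L : ℝ) := by exact_mod_cast hL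
    have hak : 0 ≤ B1.aSeq a P.L k := (B1.aSeq_pos ha hL1' hk).le
    have h := congrArg (fun T : Module.End ℝ (ScalarField P 0 N) => T ψ) (eq344_model C Finset.univ A B a k hmsq hak)
    simp only [LinearMap.add_apply, Module.End.mul_apply] at h
    have key : propagatorK C Finset.univ B msq a k (opV C Finset.univ A B msq a k (propagatorK C Finset.univ (A + B) msq a k ψ))
        = propagatorK C Finset.univ (A + B) msq a k ψ - propagatorK C Finset.univ B msq a k ψ := by
      rw [eq_sub_iff_add_eq']; exact h.symm
    rw [show (1 : ℕ) = 0 + 1 from rfl, B3Op116SourceForm.op116_succ_left_apply, B3Op116SourceForm.op116_zero_zero_apply,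
      ← opV_apply_eq_srcV C A B msq, key, LinearMap.sub_apply]
  simp only [h10] at hW
  have h := B3Op116DKernelRegularTorus.state_op116_add_left hδ₁ hδ₁1 hCst h210B h210AB hmsq ha hk hkK i₀ hs hA hδA hregA hd0
    hdδ hv hd b'.src 1 0 m 0 (dip C B b' (onb N i)) hW
  simp only [Nat.zero_add] at h
  rw [Nat.add_comm m 1]
  exact h

/-! ## §4 The theorem: the mixed entry of the kernel of (1.16), uniformly bounded and decaying for `n + n′ > d` -/

/-- **THE MIXED (DIPOLE–DIPOLE) ENTRY OF THE KERNEL OF (1.16) IS UNIFORMLY BOUNDED AND EXPONENTIALLY DECAYING ON THE TORUS, FOR ALL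
`n + n′ > d`** (the member of print's *"Hölder norms of the covariant derivatives of this kernel"* (I.2.25)/(1.32) with one covariant
derivative in each variable, p. 414; honest order count: each `G` is worth `−2`, each `V_k` and each `D` `+1`, bounded iff the order is
`< −d`, here `−(n+n′) < −d`): on `Ω = T_ε`, for `m² > 0`, `a > 0`, `1 ≤ k ≤ K`, the (2.10) bounds `Ineq210 δ₁ C` of `G_k(T,B)` and
`G_k(T,A+B)` and their twice-differentiated per-piece form with `C_M`, `0 < δ₁ ≤ 1`, `sup_b|A_b| ≤ s`, `A` (I.2.23)-regular with `δ_A`,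
`(L^kε)|e|s ≤ 1`, every direction pair `μ, ν` and sites `x, x′`:
`ε^{−d}·(ε^{−1}·Σ_i‖(D^ε_B(1.16)_{n,n′}dip^B_{⟨x′,ν⟩}e_i)(⟨x,μ⟩)‖) ≤ mixC(n+n′)·(L^kε)^{n+n′}·((L^kε)^d)^{−1}·exp(−δ^mix_{n+n′−1}·|x−x′|/L^k)` —
p40's binder `hM` of `B3Ineq25Op116Smooth.ineq25At_op116_smooth_torus_of_bounds` with `C_M·(e_Rp_R)^{n+n′} ↦ mixC(n+n′)·(L^kε)^{n+n′}`
and `δ ↦ δ^mix_{n+n′−1} = δ₁/(4L)^{n+n′+1}` (`mixRate_eq`). [cite: Balaban1983Higgs3, (1.16) p.414, (2.5) p.424, (2.10) p.426] [cite: Balaban1982Higgs1, Prop. 2.1 (2.25) p.610, (3.44) p.619] -/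
theorem kernel116_mixed_le (n n' : ℕ) (hd : P.d < n + n') (μ ν : Fin P.d) (x x' : HiggsLattice.Site P 0) :
    (P.mesh 0 ^ P.d)⁻¹ * ((P.mesh 0)⁻¹ *
        ∑ i : Ix N, ‖covDeriv C B (op116 C Finset.univ A B msq a k n n' (dip C B ⟨x', ν⟩ (onb N i))) ⟨x, μ⟩‖)
      ≤ mixC P N C k a δ₁ Cst CM s δA (n + n') * P.mesh k ^ (n + n') * (P.mesh k ^ P.d)⁻¹ *
          Real.exp (-(rateAt P N C k a Cst s δA (dipRate P δ₁) (cvDip P N C k a δ₁ Cst CM s δA) (cdDip P N C k a δ₁ Cst CM s δA)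
            (n + n' - 1) * ((HiggsLattice.Site.tdist x x' : ℝ) / (P.L : ℝ) ^ k))) := by
  have hL : 1 < P.L := hL1
  set J := n + n' - 1 with hJdef
  set M := n + n' with hMdef
  have hMJ : M = J + 1 := by omega
  have hM1 : M - 1 = J := by omega
  set cv₁ := cvDip P N C k a δ₁ Cst CM s δA
  set cd₁ := cdDip P N C k a δ₁ Cst CM s δA
  obtain ⟨-, -, hv, hdd⟩ := cvDip_cdDip_nonneg (P := P) (N := N) (C := C) (k := k) hL hδ₁ hCst hCM ha.le hs hδA
  obtain ⟨hr0, hr1, hd0, hd1⟩ := seedRate_pos_le (P := P) hδ₁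
  obtain ⟨hrJ, -, -, hcdJ⟩ := seqC_pos (P := P) (N := N) (C := C) (k := k) (a := a) (Cst := Cst) (s := s) (δA := δA)
    (δ₀ := dipRate P δ₁) (cv₀ := cv₁) (cd₀ := cd₁) hL hd0 (hd1.trans hr1) hv hdd hCst hs hδA J
  have hdM : (P.d : ℝ) < (M : ℝ) := by exact_mod_cast hd
  have hsM : 0 < (M : ℝ) - (P.d : ℝ) := by linarith
  have hε : 0 ≤ (P.mesh 0 ^ P.d)⁻¹ := inv_nonneg.mpr (pow_nonneg (P.mesh_pos 0).le _)
  have hε' : 0 ≤ (P.mesh 0)⁻¹ := inv_nonneg.mpr (P.mesh_pos 0).le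
  have hsrc : (⟨x, μ⟩ : HiggsLattice.PBond P 0).src = x := rfl
  have hsrc' : (⟨x', ν⟩ : HiggsLattice.PBond P 0).src = x' := rfl
  have hexp : (1 : ℝ) + ((J : ℕ) : ℝ) - (P.d : ℝ) = (M : ℝ) - (P.d : ℝ) := by rw [hMJ]; push_cast; ring
  -- each `i`: the state `J` of `(1.16)_{n,n′}dip^B_{⟨x′,ν⟩}e_i` (`n′ ≥ 1`: `dip_state`; `n′ = 0`: `dip_state_zero_right`)
  have hstate : ∀ i : Ix N, ‖covDeriv C B (op116 C Finset.univ A B msq a k n n' (dip C B ⟨x', ν⟩ (onb N i))) ⟨x, μ⟩‖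
      ≤ maj P k (cdAt P N C k a Cst s δA (dipRate P δ₁) cv₁ cd₁ J) (1 + ((J : ℕ) : ℝ))
          (rateAt P N C k a Cst s δA (dipRate P δ₁) cv₁ cd₁ J) x x' := by
    intro i
    cases n' with
    | zero =>
      obtain ⟨m, rfl⟩ : ∃ m, n = m + 1 := ⟨n - 1, by omega⟩
      have hJm : J = m := by omega
      have h := (dip_state_zero_right hδ₁ hδ₁1 hCst hCM h210B hmixB h210AB hmixAB hmsq ha hk hkK i₀ hs hA hδA hregA ht1 m ⟨x', ν⟩ i).2
        ⟨x, μ⟩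
      rw [hsrc, hsrc'] at h
      rw [hJm]
      exact h
    | succ n'' =>
      have hJm : J = n + n'' := by omega
      have h := (dip_state hδ₁ hδ₁1 hCst hCM h210B hmixB h210AB hmixAB hmsq ha hk hkK i₀ hs hA hδA hregA ht1 n n'' ⟨x', ν⟩ i).2 ⟨x, μ⟩
      rw [hsrc, hsrc'] at h
      rw [hJm]
      exact h
  -- the top-scale domination (p33's `majorant_le_top`, threshold `M − d > 0`)
  have hpt : ∀ i : Ix N, ‖covDeriv C B (op116 C Finset.univ A B msq a k n n' (dip C B ⟨x', ν⟩ (onb N i))) ⟨x, μ⟩‖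
      ≤ cdAt P N C k a Cst s δA (dipRate P δ₁) cv₁ cd₁ J / ((P.L : ℝ) ^ ((M : ℝ) - (P.d : ℝ)) - 1) * P.mesh k ^ ((M : ℝ) - (P.d : ℝ)) *
          Real.exp (-(rateAt P N C k a Cst s δA (dipRate P δ₁) cv₁ cd₁ J * (P.mesh k)⁻¹ *
            (P.mesh 0 * (HiggsLattice.Site.tdist x x' : ℝ)))) := by
    intro i
    refine (hstate i).trans ?_
    unfold maj
    rw [hexp]
    exact majorant_le_top hL hcdJ hsM hrJ.le x x'
  have hsplit : P.mesh k ^ ((M : ℝ) - (P.d : ℝ)) = P.mesh k ^ M * (P.mesh k ^ P.d)⁻¹ := by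
    have h := mesh_rpow_split (P := P) (k := k) 0 M
    simp only [Nat.cast_zero, zero_add, pow_zero, one_mul] at h
    exact h
  calc (P.mesh 0 ^ P.d)⁻¹ * ((P.mesh 0)⁻¹ *
        ∑ i : Ix N, ‖covDeriv C B (op116 C Finset.univ A B msq a k n n' (dip C B ⟨x', ν⟩ (onb N i))) ⟨x, μ⟩‖)
      ≤ (P.mesh 0 ^ P.d)⁻¹ * ((P.mesh 0)⁻¹ * ∑ _i : Ix N,
          cdAt P N C k a Cst s δA (dipRate P δ₁) cv₁ cd₁ J / ((P.L : ℝ) ^ ((M : ℝ) - (P.d : ℝ)) - 1) * P.mesh k ^ ((M : ℝ) - (P.d : ℝ)) *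
            Real.exp (-(rateAt P N C k a Cst s δA (dipRate P δ₁) cv₁ cd₁ J * (P.mesh k)⁻¹ *
              (P.mesh 0 * (HiggsLattice.Site.tdist x x' : ℝ))))) :=
        mul_le_mul_of_nonneg_left (mul_le_mul_of_nonneg_left (Finset.sum_le_sum fun i _ => hpt i) hε') hε
    _ = _ := by
        rw [Finset.sum_const, Finset.card_univ, nsmul_eq_mul, hsplit, rate_div_eq, mixC, hM1]
        ring

end Seeds

end Literature.MathematicalPhysics.QuantumFieldTheory.Balaban1983to89.B3Op116MixedKernelRegularTorus

end
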